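import Summits.CriticalPhenomena.PercolationContinuityZ3.Theorems.PercNearOneGluingNoHeavyLowerTailCILUnionExchangeAvoidedSplit
import HarnessLib

/-!
# `NoHeavyLowerTail` (stmt-CriticalPhenomena-4575) — Kozma–Nitzan's Theorem 1 WITH AN AVOIDED VERTEX (DOM2) from the
# conditioned covariance transfer COV(τ)

Support file (`--supports stmt-CriticalPhenomena-4575`), prover `prim-gen-induct` (gen 10).  No definitions, no named
facts, no sorries; standard axioms.

Setting (BLOBQUOTIENT.md §25–28 of the prover's notes): bond percolation `μ = prodBernoulli w` on a finite vertex type, an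
observer `o`, two terminals `a₁ ≠ a₂`, an AVOIDED vertex `a`, `U = {o↔a₁} ∪ {o↔a₂}`, `M = {a₁↔a₂}`, `Rᵢ = {aᵢ↮a}`, `D = {o↮a}`,
and an arbitrary upper family `𝒜` of edge sets read on the open edge clusters.  The pure-relay end of the anchor-gate
programme for the crux (RHLA for `|B| = 3` ⟸ AUT(|W|=2) ⟸ UX ⟸ DOM2, loc. cit. §25 (vii)–(viii)) needs the avoided-vertex
union exchange DOM2: the law of `C_o` given `o ↔ {a₁,a₂}, o ↮ a` stochastically dominates a FIXED mixture of the laws of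
`C_{a₁}` given `a₁ ↮ a` and of `C_{a₂}` given `a₂ ↮ a` (Kozma–Nitzan's Theorem 1 / the tree's `UnionExchange.pair_clusterDominance`
is the case without `a`).  The tree already has the bookkeeping half (`pair_avoided_dominance_of_split`, p194115: DOM2 at the
weight `θ` follows from two single-world covariance inequalities `(S₁^θ)`, `(S₂^{1−θ})`).  THIS FILE supplies the other half:

* `UnionExchange.tsplit_of_cov` — the single-world inequality in its t-split form (T′)
  `t₁·Cov(𝒜, o∈C_s | s↮a) + τ·Cov(𝒜, {o∈C_s, t∉C_s} | s↮a) ≥ 0` (`t₁ = μ(o↔s | s↮t, s↮a)`, `τ = μ(o↔t | t↮s, t↮a)`) from the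
  conditioned covariance transfer (COV) `Cov(𝒜, o∈C_s | s↮a) ≥ τ·Cov(𝒜, t∈C_s | s↮a)` and vdBHK Thm 1.3 in the world
  `{s↮t, s↮a}` — two lines, the `τ t₁ Cov(𝒜, t∈C_s)` terms cancel (loc. cit. §27 (iii): COV ⟹ T′);
* `UnionExchange.pair_avoided_dominance_of_cov` — DOM2: from (COV) for both owners (all upper families) there is ONE
  `θ ∈ [0,1]` (`= t₁/(t₁+t₂)`, degenerate cases `0`/`1`) giving the domination inequality for EVERY upper family.
(COV) is the cell's COV(τ) (gen-induct row (COV) = hp-8's COV(τ) = png-lead's CCT), in the tree as `CovTau.covTau_of_diagonal`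
(…CovTauAssembly) from the A2-diagonal hypothesis; the corollary "A2-diagonal ⟹ DOM2" is filed separately.
* helpers `sep_obs_posCorr` / `twoSep_obs_posCorr` (vdBHK 1.3 with `X = {a}` / `X = {t, a}` in the shapes used here), `twoSep_obs_eq`.
[cite: KozmaNitzan2024, Thm. 1 (pp. 7–8), Lemma 2 (p. 6)] [cite: VandenbergHaggstromKahn2005, Thms. 1.3–1.4 (pp. 6–7)]
-/

noncomputable section

open MeasureTheory Set
open Literature.Probability.LatticeModels (prodBernoulli)
open Literature.Probability.Percolation Literature.Probability.Percolation.KNPreFKG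

namespace Summit.CriticalPhenomena.PercolationContinuityZ3.Theorems

namespace UnionExchange

variable {V : Type*} [Fintype V]

/-- **Positive association of `C_s` given `s ↮ a`, for an upper family and an observation event** (vdBHK Thm 1.3 with
`X = {a}`): `μ(R ∩ A) μ(R ∩ {o↔s}) ≤ μ(R) μ(R ∩ A ∩ {o↔s})`, `R = {s ↮ a}`, `A = {C_s ∈ 𝒜}`.
[cite: VandenbergHaggstromKahn2005, Thm. 1.3 (p. 6)] -/
theorem sep_obs_posCorr (w : Sym2 V → unitInterval) (o s a : V) (hsa : s ≠ a)
    {𝒜 : Set (Set (Sym2 V))} (h𝒜 : IsUpperSet 𝒜) :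
    (prodBernoulli w).real ({ω : BondConfig V | ¬ (openGraph ω).Reachable s a} ∩ {ω | openEdgeCluster ω s ∈ 𝒜}) *
        (prodBernoulli w).real ({ω : BondConfig V | ¬ (openGraph ω).Reachable s a} ∩ openConn o s) ≤
      (prodBernoulli w).real {ω : BondConfig V | ¬ (openGraph ω).Reachable s a} *
        (prodBernoulli w).real ({ω : BondConfig V | ¬ (openGraph ω).Reachable s a} ∩
          {ω | openEdgeCluster ω s ∈ 𝒜} ∩ openConn o s) := by
  have hD : {ω : BondConfig V | ∀ x ∈ ({a} : Set V), ¬ (openGraph ω).Reachable s x} =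
      {ω : BondConfig V | ¬ (openGraph ω).Reachable s a} := by
    ext ω; simp only [mem_setOf_eq, mem_singleton_iff, forall_eq]
  have h := bhk_one_upper_upper w s ({a} : Set V) (by simpa using hsa) h𝒜 (isUpperSet_connFamily s o)
  rw [hD, ← openConn_eq_setOf_connFamily, openConn_symm s o, ← inter_assoc] at h
  exact h

/-- **Positive association of `C_s` given `s ↮ t, s ↮ a`** (vdBHK Thm 1.3 with `X = {t, a}`), written on the pieces of
`R = {s ↮ a}`: `μ(E ∩ A) μ(R ∩ {o↔s} ∩ Mᶜ) ≤ μ(E) μ(R ∩ A ∩ {o↔s} ∩ Mᶜ)` with `Mᶜ = {s ↮ t}`, `E = Mᶜ ∩ R`,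
`μ(E ∩ A) = μ(R ∩ A) − μ(R ∩ A ∩ {s↔t})`. [cite: VandenbergHaggstromKahn2005, Thm. 1.3 (p. 6)] -/
theorem twoSep_obs_posCorr (w : Sym2 V → unitInterval) (o s t a : V) (hst : s ≠ t) (hsa : s ≠ a)
    {𝒜 : Set (Set (Sym2 V))} (h𝒜 : IsUpperSet 𝒜) :
    ((prodBernoulli w).real ({ω : BondConfig V | ¬ (openGraph ω).Reachable s a} ∩ {ω | openEdgeCluster ω s ∈ 𝒜}) -
        (prodBernoulli w).real ({ω : BondConfig V | ¬ (openGraph ω).Reachable s a} ∩ openConn s t ∩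
          {ω | openEdgeCluster ω s ∈ 𝒜})) *
        (prodBernoulli w).real ({ω : BondConfig V | ¬ (openGraph ω).Reachable s a} ∩ openConn o s ∩
          {ω : BondConfig V | ¬ (openGraph ω).Reachable s t}) ≤
      (prodBernoulli w).real ({ω : BondConfig V | ¬ (openGraph ω).Reachable s t} ∩
          {ω : BondConfig V | ¬ (openGraph ω).Reachable s a}) *
        (prodBernoulli w).real ({ω : BondConfig V | ¬ (openGraph ω).Reachable s a} ∩
          {ω | openEdgeCluster ω s ∈ 𝒜} ∩ openConn o s ∩ {ω : BondConfig V | ¬ (openGraph ω).Reachable s t}) := by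
  classical
  set μ := prodBernoulli w with hμ
  set R : Set (BondConfig V) := {ω : BondConfig V | ¬ (openGraph ω).Reachable s a} with hR
  set Mc : Set (BondConfig V) := {ω : BondConfig V | ¬ (openGraph ω).Reachable s t} with hMc
  set A : Set (BondConfig V) := {ω | openEdgeCluster ω s ∈ 𝒜} with hA
  set O : Set (BondConfig V) := openConn o s with hO
  have hD : {ω : BondConfig V | ∀ x ∈ ({t, a} : Set V), ¬ (openGraph ω).Reachable s x} = Mc ∩ R := by
    ext ω
    simp only [mem_setOf_eq, mem_insert_iff, mem_singleton_iff, forall_eq_or_imp, forall_eq, hMc, hR, mem_inter_iff]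
  have hs : s ∉ ({t, a} : Set V) := by
    simp only [mem_insert_iff, mem_singleton_iff, not_or]; exact ⟨hst, hsa⟩
  have h := bhk_one_upper_upper w s ({t, a} : Set V) hs h𝒜 (isUpperSet_connFamily s o)
  rw [hD, ← openConn_eq_setOf_connFamily, openConn_symm s o] at h
  -- `μ((Mᶜ ∩ R) ∩ A) = μ(R ∩ A) − μ(R ∩ M ∩ A)`
  have hsplit : μ.real (R ∩ A) = μ.real (R ∩ A ∩ openConn s t) + μ.real (R ∩ A ∩ (openConn s t)ᶜ) := by
    rw [← measureReal_inter_add_sdiff (s := R ∩ A) (MeasurableSet.of_discrete : MeasurableSet (openConn s t : Set (BondConfig V))),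
      Set.sdiff_eq]
  have hc : ((openConn s t)ᶜ : Set (BondConfig V)) = Mc := by
    ext ω; simp only [mem_compl_iff, openConn, mem_setOf_eq, hMc]
  have e1 : Mc ∩ R ∩ A = R ∩ A ∩ (openConn s t)ᶜ := by
    rw [hc, inter_comm Mc R, inter_assoc, inter_comm Mc A, ← inter_assoc]
  have e2 : Mc ∩ R ∩ O = R ∩ O ∩ Mc := by
    rw [inter_comm Mc R, inter_assoc, inter_comm Mc O, ← inter_assoc]
  have e3 : Mc ∩ R ∩ (A ∩ O) = R ∩ A ∩ O ∩ Mc := by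
    rw [inter_comm Mc R, inter_assoc, inter_comm Mc (A ∩ O), ← inter_assoc, ← inter_assoc]
  have e4 : R ∩ openConn s t ∩ A = R ∩ A ∩ openConn s t := by
    rw [inter_assoc, inter_comm (openConn s t : Set (BondConfig V)) A, ← inter_assoc]
  rw [e1, e2, e3] at h
  rw [e4, hsplit, add_sub_cancel_left]
  exact h

omit [Fintype V] in
/-- The set identity behind `t₁ = μ(o↔s | s↮t, s↮a)`: `{s↮t} ∩ {s↮a} ∩ {s↔o} = {s↮a} ∩ {o↔s} ∩ {s↮t}`. [folklore] -/
theorem twoSep_obs_eq (o s t a : V) :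
    ({ω : BondConfig V | ¬ (openGraph ω).Reachable s t} ∩ {ω : BondConfig V | ¬ (openGraph ω).Reachable s a} ∩
        openConn s o : Set (BondConfig V)) =
      {ω : BondConfig V | ¬ (openGraph ω).Reachable s a} ∩ openConn o s ∩
        {ω : BondConfig V | ¬ (openGraph ω).Reachable s t} := by
  ext ω
  simp only [mem_inter_iff, mem_setOf_eq, openConn]
  constructor
  · rintro ⟨⟨h1, h2⟩, h3⟩; exact ⟨⟨h2, h3.symm⟩, h1⟩
  · rintro ⟨⟨h2, h3⟩, h1⟩; exact ⟨⟨h1, h2⟩, h3.symm⟩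

/-- **The t-split (T′) from the conditioned covariance transfer COV(τ)** — the single-world hypothesis of the DOM2 reduction,
denominator-free.  Owner `s`, second terminal `t`, avoided vertex `a`, observer `o`; `R = {s↮a}`, `A = {C_s ∈ 𝒜}` (`𝒜` upper),
`O = {o↔s}`, `M = {s↔t}`; `E₁ = {s↮t, s↮a}`, `E₂ = {t↮s, t↮a}`.  IF
(COV) `μ(E₂ ∩ {t↔o}) · cov_R(A, M) ≤ μ(E₂) · cov_R(A, O)` (`cov_R(A, B) = μ(R) μ(R∩A∩B) − μ(R∩A) μ(R∩B)`; this is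
`Cov(𝒜, o∈C_s | s↮a) ≥ τ · Cov(𝒜, t∈C_s | s↮a)`, `τ = μ(o↔t | t↮s, t↮a)`), THEN
(T′) `0 ≤ μ(E₁ ∩ {s↔o}) μ(E₂) · cov_R(A, O) + μ(E₂ ∩ {t↔o}) μ(E₁) · cov_R(A, O ∩ Mᶜ)`,
i.e. `t₁·Cov(𝒜, o∈C) + τ·Cov(𝒜, {o∈C, t∉C}) ≥ 0` with `t₁ = μ(o↔s | s↮t, s↮a)`.  Proof: (COV) and vdBHK Thm 1.3 in the world
`E₁` (`Cov(𝒜, O∩Mᶜ) ≥ −t₁·Cov(𝒜, M)`); the two `τ t₁ Cov(𝒜, M)` terms cancel.  (BLOBQUOTIENT §27(iii): COV ⟹ T′.)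
[cite: VandenbergHaggstromKahn2005, Thms. 1.3–1.4 (pp. 6–7)] [cite: KozmaNitzan2024, Thm. 1 (pp. 7–8), Lemma 2 (p. 6)] -/
theorem tsplit_of_cov (w : Sym2 V → unitInterval) (o s t a : V) (hst : s ≠ t) (hsa : s ≠ a)
    {𝒜 : Set (Set (Sym2 V))} (h𝒜 : IsUpperSet 𝒜)
    (hCOV : (prodBernoulli w).real ({ω : BondConfig V | ¬ (openGraph ω).Reachable t s} ∩
          {ω | ¬ (openGraph ω).Reachable t a} ∩ openConn t o) *
        ((prodBernoulli w).real {ω : BondConfig V | ¬ (openGraph ω).Reachable s a} *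
            (prodBernoulli w).real ({ω : BondConfig V | ¬ (openGraph ω).Reachable s a} ∩ openConn s t ∩
              {ω | openEdgeCluster ω s ∈ 𝒜}) -
          (prodBernoulli w).real ({ω : BondConfig V | ¬ (openGraph ω).Reachable s a} ∩ {ω | openEdgeCluster ω s ∈ 𝒜}) *
            (prodBernoulli w).real ({ω : BondConfig V | ¬ (openGraph ω).Reachable s a} ∩ openConn s t)) ≤
      (prodBernoulli w).real ({ω : BondConfig V | ¬ (openGraph ω).Reachable t s} ∩
          {ω | ¬ (openGraph ω).Reachable t a}) *
        ((prodBernoulli w).real {ω : BondConfig V | ¬ (openGraph ω).Reachable s a} *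
            (prodBernoulli w).real ({ω : BondConfig V | ¬ (openGraph ω).Reachable s a} ∩ openConn s o ∩
              {ω | openEdgeCluster ω s ∈ 𝒜}) -
          (prodBernoulli w).real ({ω : BondConfig V | ¬ (openGraph ω).Reachable s a} ∩ {ω | openEdgeCluster ω s ∈ 𝒜}) *
            (prodBernoulli w).real ({ω : BondConfig V | ¬ (openGraph ω).Reachable s a} ∩ openConn s o))) :
    0 ≤ (prodBernoulli w).real ({ω : BondConfig V | ¬ (openGraph ω).Reachable s t} ∩
            {ω : BondConfig V | ¬ (openGraph ω).Reachable s a} ∩ openConn s o) *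
          (prodBernoulli w).real ({ω : BondConfig V | ¬ (openGraph ω).Reachable t s} ∩
            {ω | ¬ (openGraph ω).Reachable t a}) *
          ((prodBernoulli w).real {ω : BondConfig V | ¬ (openGraph ω).Reachable s a} *
              (prodBernoulli w).real ({ω : BondConfig V | ¬ (openGraph ω).Reachable s a} ∩
                {ω | openEdgeCluster ω s ∈ 𝒜} ∩ openConn o s) -
            (prodBernoulli w).real ({ω : BondConfig V | ¬ (openGraph ω).Reachable s a} ∩ {ω | openEdgeCluster ω s ∈ 𝒜}) *
              (prodBernoulli w).real ({ω : BondConfig V | ¬ (openGraph ω).Reachable s a} ∩ openConn o s)) +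
        (prodBernoulli w).real ({ω : BondConfig V | ¬ (openGraph ω).Reachable t s} ∩
            {ω | ¬ (openGraph ω).Reachable t a} ∩ openConn t o) *
          (prodBernoulli w).real ({ω : BondConfig V | ¬ (openGraph ω).Reachable s t} ∩
            {ω : BondConfig V | ¬ (openGraph ω).Reachable s a}) *
          ((prodBernoulli w).real {ω : BondConfig V | ¬ (openGraph ω).Reachable s a} *
              (prodBernoulli w).real ({ω : BondConfig V | ¬ (openGraph ω).Reachable s a} ∩
                {ω | openEdgeCluster ω s ∈ 𝒜} ∩ openConn o s ∩ {ω : BondConfig V | ¬ (openGraph ω).Reachable s t}) -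
            (prodBernoulli w).real ({ω : BondConfig V | ¬ (openGraph ω).Reachable s a} ∩ {ω | openEdgeCluster ω s ∈ 𝒜}) *
              (prodBernoulli w).real ({ω : BondConfig V | ¬ (openGraph ω).Reachable s a} ∩ openConn o s ∩
                {ω : BondConfig V | ¬ (openGraph ω).Reachable s t})) := by
  classical
  set μ := prodBernoulli w with hμ
  set R : Set (BondConfig V) := {ω : BondConfig V | ¬ (openGraph ω).Reachable s a} with hR
  set Mc : Set (BondConfig V) := {ω : BondConfig V | ¬ (openGraph ω).Reachable s t} with hMc
  set A : Set (BondConfig V) := {ω | openEdgeCluster ω s ∈ 𝒜} with hA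
  set O : Set (BondConfig V) := openConn o s with hO
  set Sa : Set (BondConfig V) := {ω : BondConfig V | ¬ (openGraph ω).Reachable t s} ∩
    {ω | ¬ (openGraph ω).Reachable t a} with hSa
  -- normalise the observation event of the hypothesis: `{s↔o} = {o↔s}`
  have hOs : (openConn s o : Set (BondConfig V)) = O := by rw [hO, openConn_symm]
  have e1 : R ∩ openConn s o ∩ A = R ∩ A ∩ O := by rw [hOs, inter_assoc, inter_comm O A, ← inter_assoc]
  rw [e1, hOs] at hCOV
  -- `μ(E₁ ∩ {s↔o}) = μ(R ∩ O ∩ Mᶜ)`, `μ(E₁) = μ(R) − μ(R ∩ M)`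
  have heo : μ.real (Mc ∩ R ∩ openConn s o) = μ.real (R ∩ O ∩ Mc) := by
    rw [show (Mc ∩ R ∩ openConn s o : Set (BondConfig V)) = R ∩ O ∩ Mc from twoSep_obs_eq o s t a]
  have hc : ((openConn s t)ᶜ : Set (BondConfig V)) = Mc := by
    ext ω; simp only [mem_compl_iff, openConn, mem_setOf_eq, hMc]
  have hsplitR : μ.real R = μ.real (R ∩ openConn s t) + μ.real (Mc ∩ R) := by
    rw [← measureReal_inter_add_sdiff (s := R) (MeasurableSet.of_discrete : MeasurableSet (openConn s t : Set (BondConfig V))),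
      Set.sdiff_eq, hc, inter_comm R Mc]
  -- vdBHK 1.3 in the world `E₁`
  have hB := twoSep_obs_posCorr w o s t a hst hsa h𝒜
  simp only [← hμ, ← hR, ← hMc, ← hA, ← hO] at hB
  -- nonnegativity
  have n1 : 0 ≤ μ.real (Mc ∩ R ∩ openConn s o) := measureReal_nonneg
  have n2 : 0 ≤ μ.real (Sa ∩ openConn t o) := measureReal_nonneg
  have n3 : 0 ≤ μ.real R := measureReal_nonneg
  -- (COV) × μ(E₁ ∩ {s↔o}) and (vdBHK 1.3) × μ(E₂ ∩ {t↔o}) μ(R)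
  have h1 := mul_le_mul_of_nonneg_left hCOV n1
  have h2 := mul_le_mul_of_nonneg_left hB (mul_nonneg n2 n3)
  have h3 : μ.real (Sa ∩ openConn t o) * μ.real (R ∩ O ∩ Mc) * μ.real (R ∩ A) * μ.real R =
      μ.real (Sa ∩ openConn t o) * μ.real (R ∩ O ∩ Mc) * μ.real (R ∩ A) * μ.real (R ∩ openConn s t) +
        μ.real (Sa ∩ openConn t o) * μ.real (R ∩ O ∩ Mc) * μ.real (R ∩ A) * μ.real (Mc ∩ R) := by
    rw [hsplitR]; ring
  rw [heo] at h1 ⊢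
  nlinarith [h1, h2, h3]

/-- **Kozma–Nitzan's Theorem 1 WITH AN AVOIDED VERTEX (DOM2) from the two conditioned covariance transfers.**
Observer `o`, terminals `a₁ ≠ a₂`, avoided vertex `a ∉ {a₁, a₂}`; `Oᵢ = {o↔aᵢ}`, `M = {a₁↔a₂}`, `Rᵢ = {aᵢ↮a}`, `D = {o↮a}`,
`Aᵥ = {C_v ∈ 𝒜}`.  IF the conditioned covariance transfer COV(τ) holds for both owners and every upper family
(`hCOV₁`: owner `a₁`, `τ = μ(o↔a₂ | a₂↮a₁, a₂↮a)`; `hCOV₂`: owner `a₂`), THEN there is ONE `θ ∈ [0, 1]` such that for EVERY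
upper family `𝒜`
`Λ₁(θ)·μ(R₂)·μ(R₁ ∩ A₁) + Λ₂(θ)·μ(R₁)·μ(R₂ ∩ A₂) ≤ μ(R₁) μ(R₂) μ((O₁ ∪ O₂) ∩ D ∩ A_o)`,
`Λ₁(θ) = μ(R₁∩O₁∩Mᶜ) + θ μ(R₁∩O₁∩M)`, `Λ₂(θ) = μ(R₂∩O₂∩Mᶜ) + (1−θ) μ(R₂∩O₂∩M)` (so `Λ₁/μ(R₁) + Λ₂/μ(R₂)` has total mass
`μ((O₁∪O₂) ∩ D)`): the law of `C_o` given `o ↔ {a₁,a₂}, o ↮ a` stochastically dominates a FIXED mixture of the laws of `C_{a₁}`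
given `a₁ ↮ a` and of `C_{a₂}` given `a₂ ↮ a` — the avoided-vertex union exchange DOM2 of the crux line (BLOBQUOTIENT §26–27:
DOM2 ⟹ UX ⟹ AUT(|W|=2) ⟹ RHLA(|B|=3)), Kozma–Nitzan's Theorem 1 being the case without `a`.  Proof: `θ = t₁/(t₁+t₂)`
(`tᵢ = μ(o↔aᵢ | aᵢ↮a_{3−i}, aᵢ↮a)`; degenerate cases `θ ∈ {0,1}`), the t-splits `tsplit_of_cov` for both owners, and the
bookkeeping `pair_avoided_dominance_of_split`. [cite: KozmaNitzan2024, Thm. 1 (pp. 7–8)] [cite: VandenbergHaggstromKahn2005, Thms. 1.3–1.4 (pp. 6–7)] -/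
theorem pair_avoided_dominance_of_cov (w : Sym2 V → unitInterval) (o a₁ a₂ a : V) (h12 : a₁ ≠ a₂) (h1a : a₁ ≠ a)
    (h2a : a₂ ≠ a)
    (hCOV₁ : ∀ 𝒜 : Set (Set (Sym2 V)), IsUpperSet 𝒜 →
      (prodBernoulli w).real ({ω : BondConfig V | ¬ (openGraph ω).Reachable a₂ a₁} ∩
          {ω | ¬ (openGraph ω).Reachable a₂ a} ∩ openConn a₂ o) *
        ((prodBernoulli w).real {ω : BondConfig V | ¬ (openGraph ω).Reachable a₁ a} *
            (prodBernoulli w).real ({ω : BondConfig V | ¬ (openGraph ω).Reachable a₁ a} ∩ openConn a₁ a₂ ∩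
              {ω | openEdgeCluster ω a₁ ∈ 𝒜}) -
          (prodBernoulli w).real ({ω : BondConfig V | ¬ (openGraph ω).Reachable a₁ a} ∩ {ω | openEdgeCluster ω a₁ ∈ 𝒜}) *
            (prodBernoulli w).real ({ω : BondConfig V | ¬ (openGraph ω).Reachable a₁ a} ∩ openConn a₁ a₂)) ≤
      (prodBernoulli w).real ({ω : BondConfig V | ¬ (openGraph ω).Reachable a₂ a₁} ∩
          {ω | ¬ (openGraph ω).Reachable a₂ a}) *
        ((prodBernoulli w).real {ω : BondConfig V | ¬ (openGraph ω).Reachable a₁ a} *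
            (prodBernoulli w).real ({ω : BondConfig V | ¬ (openGraph ω).Reachable a₁ a} ∩ openConn a₁ o ∩
              {ω | openEdgeCluster ω a₁ ∈ 𝒜}) -
          (prodBernoulli w).real ({ω : BondConfig V | ¬ (openGraph ω).Reachable a₁ a} ∩ {ω | openEdgeCluster ω a₁ ∈ 𝒜}) *
            (prodBernoulli w).real ({ω : BondConfig V | ¬ (openGraph ω).Reachable a₁ a} ∩ openConn a₁ o)))
    (hCOV₂ : ∀ 𝒜 : Set (Set (Sym2 V)), IsUpperSet 𝒜 →
      (prodBernoulli w).real ({ω : BondConfig V | ¬ (openGraph ω).Reachable a₁ a₂} ∩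
          {ω | ¬ (openGraph ω).Reachable a₁ a} ∩ openConn a₁ o) *
        ((prodBernoulli w).real {ω : BondConfig V | ¬ (openGraph ω).Reachable a₂ a} *
            (prodBernoulli w).real ({ω : BondConfig V | ¬ (openGraph ω).Reachable a₂ a} ∩ openConn a₂ a₁ ∩
              {ω | openEdgeCluster ω a₂ ∈ 𝒜}) -
          (prodBernoulli w).real ({ω : BondConfig V | ¬ (openGraph ω).Reachable a₂ a} ∩ {ω | openEdgeCluster ω a₂ ∈ 𝒜}) *
            (prodBernoulli w).real ({ω : BondConfig V | ¬ (openGraph ω).Reachable a₂ a} ∩ openConn a₂ a₁)) ≤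
      (prodBernoulli w).real ({ω : BondConfig V | ¬ (openGraph ω).Reachable a₁ a₂} ∩
          {ω | ¬ (openGraph ω).Reachable a₁ a}) *
        ((prodBernoulli w).real {ω : BondConfig V | ¬ (openGraph ω).Reachable a₂ a} *
            (prodBernoulli w).real ({ω : BondConfig V | ¬ (openGraph ω).Reachable a₂ a} ∩ openConn a₂ o ∩
              {ω | openEdgeCluster ω a₂ ∈ 𝒜}) -
          (prodBernoulli w).real ({ω : BondConfig V | ¬ (openGraph ω).Reachable a₂ a} ∩ {ω | openEdgeCluster ω a₂ ∈ 𝒜}) *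
            (prodBernoulli w).real ({ω : BondConfig V | ¬ (openGraph ω).Reachable a₂ a} ∩ openConn a₂ o))) :
    ∃ θ : ℝ, 0 ≤ θ ∧ θ ≤ 1 ∧ ∀ 𝒜 : Set (Set (Sym2 V)), IsUpperSet 𝒜 →
      (prodBernoulli w).real {ω : BondConfig V | ¬ (openGraph ω).Reachable a₂ a} *
          ((prodBernoulli w).real ({ω : BondConfig V | ¬ (openGraph ω).Reachable a₁ a} ∩ openConn o a₁ ∩
              {ω | ¬ (openGraph ω).Reachable a₁ a₂}) +
            θ * (prodBernoulli w).real ({ω : BondConfig V | ¬ (openGraph ω).Reachable a₁ a} ∩ openConn o a₁ ∩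
              openConn a₁ a₂)) *
          (prodBernoulli w).real ({ω : BondConfig V | ¬ (openGraph ω).Reachable a₁ a} ∩
            {ω | openEdgeCluster ω a₁ ∈ 𝒜}) +
        (prodBernoulli w).real {ω : BondConfig V | ¬ (openGraph ω).Reachable a₁ a} *
          ((prodBernoulli w).real ({ω : BondConfig V | ¬ (openGraph ω).Reachable a₂ a} ∩ openConn o a₂ ∩
              {ω | ¬ (openGraph ω).Reachable a₁ a₂}) +
            (1 - θ) * (prodBernoulli w).real ({ω : BondConfig V | ¬ (openGraph ω).Reachable a₂ a} ∩
              openConn o a₂ ∩ openConn a₁ a₂)) *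
          (prodBernoulli w).real ({ω : BondConfig V | ¬ (openGraph ω).Reachable a₂ a} ∩
            {ω | openEdgeCluster ω a₂ ∈ 𝒜}) ≤
      (prodBernoulli w).real {ω : BondConfig V | ¬ (openGraph ω).Reachable a₁ a} *
        (prodBernoulli w).real {ω : BondConfig V | ¬ (openGraph ω).Reachable a₂ a} *
        (prodBernoulli w).real ((openConn o a₁ ∪ openConn o a₂) ∩
          {ω : BondConfig V | ¬ (openGraph ω).Reachable o a} ∩ {ω | openEdgeCluster ω o ∈ 𝒜}) := by
  classical
  set μ := prodBernoulli w with hμ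
  set O₁ : Set (BondConfig V) := openConn o a₁ with hO₁
  set O₂ : Set (BondConfig V) := openConn o a₂ with hO₂
  set Mr : Set (BondConfig V) := openConn a₁ a₂ with hMr
  set Mc : Set (BondConfig V) := {ω | ¬ (openGraph ω).Reachable a₁ a₂} with hMc
  set R₁ : Set (BondConfig V) := {ω | ¬ (openGraph ω).Reachable a₁ a} with hR₁
  set R₂ : Set (BondConfig V) := {ω | ¬ (openGraph ω).Reachable a₂ a} with hR₂
  -- normalise the orientation-2 spellings `{a₂↮a₁}`, `{a₂↔a₁}`
  have hMc' : {ω : BondConfig V | ¬ (openGraph ω).Reachable a₂ a₁} = Mc := by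
    ext ω; simp only [mem_setOf_eq, hMc]; exact ⟨fun h h' => h h'.symm, fun h h' => h h'.symm⟩
  -- the two t-splits, for every upper family
  have T1 : ∀ 𝒜 : Set (Set (Sym2 V)), IsUpperSet 𝒜 → _ := fun 𝒜 h𝒜 =>
    tsplit_of_cov w o a₁ a₂ a h12 h1a h𝒜 (hCOV₁ 𝒜 h𝒜)
  have T2 : ∀ 𝒜 : Set (Set (Sym2 V)), IsUpperSet 𝒜 → _ := fun 𝒜 h𝒜 =>
    tsplit_of_cov w o a₂ a₁ a h12.symm h2a h𝒜 (hCOV₂ 𝒜 h𝒜)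
  simp only [hMc', ← hμ, ← hMc, ← hR₁, ← hR₂, ← hO₁, ← hO₂] at T1 T2
  -- the constants: `eoᵢ = μ(Eᵢ ∩ {aᵢ↔o})`, `eᵢ = μ(Eᵢ)`
  set e₁ : ℝ := μ.real (Mc ∩ R₁) with he₁
  set e₂ : ℝ := μ.real (Mc ∩ R₂) with he₂
  set eo₁ : ℝ := μ.real (Mc ∩ R₁ ∩ openConn a₁ o) with heo₁
  set eo₂ : ℝ := μ.real (Mc ∩ R₂ ∩ openConn a₂ o) with heo₂
  have n_e₁ : 0 ≤ e₁ := measureReal_nonneg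
  have n_e₂ : 0 ≤ e₂ := measureReal_nonneg
  have n_eo₁ : 0 ≤ eo₁ := measureReal_nonneg
  have n_eo₂ : 0 ≤ eo₂ := measureReal_nonneg
  have l_eo₁ : eo₁ ≤ e₁ := measureReal_mono inter_subset_left (measure_ne_top _ _)
  have l_eo₂ : eo₂ ≤ e₂ := measureReal_mono inter_subset_left (measure_ne_top _ _)
  -- `eoᵢ` is the mass of the piece `Rᵢ ∩ Oᵢ ∩ Mᶜ`
  have heq₁ : eo₁ = μ.real (R₁ ∩ O₁ ∩ Mc) := by
    rw [heo₁, show (Mc ∩ R₁ ∩ openConn a₁ o : Set (BondConfig V)) = R₁ ∩ O₁ ∩ Mc from twoSep_obs_eq o a₁ a₂ a]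
  have heq₂ : eo₂ = μ.real (R₂ ∩ O₂ ∩ Mc) := by
    rw [heo₂, ← hMc', show ({ω : BondConfig V | ¬ (openGraph ω).Reachable a₂ a₁} ∩ R₂ ∩ openConn a₂ o : Set (BondConfig V)) =
      R₂ ∩ O₂ ∩ {ω : BondConfig V | ¬ (openGraph ω).Reachable a₂ a₁} from twoSep_obs_eq o a₂ a₁ a, hMc']
  -- additivity over `M / Mᶜ`
  have hc : (Mrᶜ : Set (BondConfig V)) = Mc := by
    ext ω; simp only [mem_compl_iff, hMr, openConn, mem_setOf_eq, hMc]
  have hsplit : ∀ S : Set (BondConfig V), μ.real S = μ.real (S ∩ Mc) + μ.real (S ∩ Mr) := by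
    intro S
    rw [← measureReal_inter_add_sdiff (s := S) (MeasurableSet.of_discrete : MeasurableSet Mr), Set.sdiff_eq, hc, add_comm]
  -- positive association in each world `Rᵢ` (vdBHK 1.3, `X = {a}`)
  have PA1 : ∀ 𝒜 : Set (Set (Sym2 V)), IsUpperSet 𝒜 → _ := fun 𝒜 h𝒜 => sep_obs_posCorr w o a₁ a h1a h𝒜
  have PA2 : ∀ 𝒜 : Set (Set (Sym2 V)), IsUpperSet 𝒜 → _ := fun 𝒜 h𝒜 => sep_obs_posCorr w o a₂ a h2a h𝒜
  simp only [← hμ, ← hR₁, ← hR₂, ← hO₁, ← hO₂] at PA1 PA2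
  by_cases hZ : eo₁ * e₂ + eo₂ * e₁ = 0
  · -- degenerate: `θ ∈ {0, 1}`
    have hz1 : eo₁ * e₂ = 0 := by nlinarith [mul_nonneg n_eo₁ n_e₂, mul_nonneg n_eo₂ n_e₁]
    have hz2 : eo₂ * e₁ = 0 := by nlinarith [mul_nonneg n_eo₁ n_e₂, mul_nonneg n_eo₂ n_e₁]
    by_cases h1 : eo₁ = 0
    · refine ⟨0, le_refl _, zero_le_one, fun 𝒜 h𝒜 => ?_⟩
      have hA1 : μ.real (R₁ ∩ {ω | openEdgeCluster ω a₁ ∈ 𝒜} ∩ O₁ ∩ Mc) = 0 :=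
        le_antisymm ((measureReal_mono (by intro ω hω; exact ⟨⟨hω.1.1.1, hω.1.2⟩, hω.2⟩) (measure_ne_top _ _)).trans
          (heq₁ ▸ h1).le) measureReal_nonneg
      refine pair_avoided_dominance_of_split w o a₁ a₂ a 0 ?_ ?_
      · simp only [← hμ, ← hR₁, ← hO₁, ← hMc, ← hMr, zero_mul, add_zero]
        rw [← heq₁, h1, hA1, mul_zero, mul_zero]
      · simp only [← hμ, ← hR₂, ← hO₂, ← hMc, ← hMr, sub_zero, one_mul]
        have := PA2 𝒜 h𝒜
        rw [hsplit (R₂ ∩ O₂), hsplit (R₂ ∩ {ω | openEdgeCluster ω a₂ ∈ 𝒜} ∩ O₂)] at this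
        exact this
    · have h2 : e₂ = 0 := by
        rcases mul_eq_zero.1 hz1 with h | h
        · exact absurd h h1
        · exact h
      have h3 : eo₂ = 0 := le_antisymm (h2 ▸ l_eo₂) n_eo₂
      refine ⟨1, zero_le_one, le_refl _, fun 𝒜 h𝒜 => ?_⟩
      have hA2 : μ.real (R₂ ∩ {ω | openEdgeCluster ω a₂ ∈ 𝒜} ∩ O₂ ∩ Mc) = 0 :=
        le_antisymm ((measureReal_mono (by intro ω hω; exact ⟨⟨hω.1.1.1, hω.1.2⟩, hω.2⟩) (measure_ne_top _ _)).trans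
          (heq₂ ▸ h3).le) measureReal_nonneg
      refine pair_avoided_dominance_of_split w o a₁ a₂ a 1 ?_ ?_
      · simp only [← hμ, ← hR₁, ← hO₁, ← hMc, ← hMr, one_mul]
        have := PA1 𝒜 h𝒜
        rw [hsplit (R₁ ∩ O₁), hsplit (R₁ ∩ {ω | openEdgeCluster ω a₁ ∈ 𝒜} ∩ O₁)] at this
        exact this
      · simp only [← hμ, ← hR₂, ← hO₂, ← hMc, ← hMr, sub_self, zero_mul, add_zero]
        rw [← heq₂, h3, hA2, mul_zero, mul_zero]
  · -- generic: `θ = t₁/(t₁+t₂) = eo₁ e₂ / (eo₁ e₂ + eo₂ e₁)`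
    have hZpos : 0 < eo₁ * e₂ + eo₂ * e₁ :=
      lt_of_le_of_ne (add_nonneg (mul_nonneg n_eo₁ n_e₂) (mul_nonneg n_eo₂ n_e₁)) (Ne.symm hZ)
    set θ : ℝ := eo₁ * e₂ / (eo₁ * e₂ + eo₂ * e₁) with hθ
    have hθZ : θ * (eo₁ * e₂ + eo₂ * e₁) = eo₁ * e₂ := div_mul_cancel₀ _ hZ
    have hθZ' : (1 - θ) * (eo₁ * e₂ + eo₂ * e₁) = eo₂ * e₁ := by rw [sub_mul, hθZ]; ring
    refine ⟨θ, div_nonneg (mul_nonneg n_eo₁ n_e₂) hZpos.le,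
      (div_le_one hZpos).2 (le_add_of_nonneg_right (mul_nonneg n_eo₂ n_e₁)), fun 𝒜 h𝒜 => ?_⟩
    have t1 := T1 𝒜 h𝒜
    have t2 := T2 𝒜 h𝒜
    refine pair_avoided_dominance_of_split w o a₁ a₂ a θ ?_ ?_
    · simp only [← hμ, ← hR₁, ← hO₁, ← hMc, ← hMr]
      set A₁ : Set (BondConfig V) := {ω | openEdgeCluster ω a₁ ∈ 𝒜} with hA₁
      rw [heq₁] at t1
      have s1 := hsplit (R₁ ∩ O₁)
      have s2 := hsplit (R₁ ∩ A₁ ∩ O₁)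
      refine le_of_mul_le_mul_right ?_ hZpos
      have key : (μ.real R₁ * (μ.real (R₁ ∩ A₁ ∩ O₁ ∩ Mc) + θ * μ.real (R₁ ∩ A₁ ∩ O₁ ∩ Mr)) -
          μ.real (R₁ ∩ A₁) * (μ.real (R₁ ∩ O₁ ∩ Mc) + θ * μ.real (R₁ ∩ O₁ ∩ Mr))) * (eo₁ * e₂ + eo₂ * e₁) =
          μ.real (R₁ ∩ O₁ ∩ Mc) * e₂ * (μ.real R₁ * μ.real (R₁ ∩ A₁ ∩ O₁) - μ.real (R₁ ∩ A₁) * μ.real (R₁ ∩ O₁)) +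
          eo₂ * e₁ * (μ.real R₁ * μ.real (R₁ ∩ A₁ ∩ O₁ ∩ Mc) - μ.real (R₁ ∩ A₁) * μ.real (R₁ ∩ O₁ ∩ Mc)) := by
        rw [s1, s2]
        have : θ * (eo₁ * e₂ + eo₂ * e₁) = μ.real (R₁ ∩ O₁ ∩ Mc) * e₂ := by rw [hθZ, heq₁]
        linear_combination (μ.real R₁ * μ.real (R₁ ∩ A₁ ∩ O₁ ∩ Mr) - μ.real (R₁ ∩ A₁) * μ.real (R₁ ∩ O₁ ∩ Mr)) * this +
          (e₂ * (μ.real R₁ * μ.real (R₁ ∩ A₁ ∩ O₁ ∩ Mc) - μ.real (R₁ ∩ A₁) * μ.real (R₁ ∩ O₁ ∩ Mc))) * heq₁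
      linarith [key, t1]
    · simp only [← hμ, ← hR₂, ← hO₂, ← hMc, ← hMr]
      set A₂ : Set (BondConfig V) := {ω | openEdgeCluster ω a₂ ∈ 𝒜} with hA₂
      rw [heq₂] at t2
      have s1 := hsplit (R₂ ∩ O₂)
      have s2 := hsplit (R₂ ∩ A₂ ∩ O₂)
      refine le_of_mul_le_mul_right ?_ hZpos
      have key : (μ.real R₂ * (μ.real (R₂ ∩ A₂ ∩ O₂ ∩ Mc) + (1 - θ) * μ.real (R₂ ∩ A₂ ∩ O₂ ∩ Mr)) -
          μ.real (R₂ ∩ A₂) * (μ.real (R₂ ∩ O₂ ∩ Mc) + (1 - θ) * μ.real (R₂ ∩ O₂ ∩ Mr))) * (eo₁ * e₂ + eo₂ * e₁) =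
          μ.real (R₂ ∩ O₂ ∩ Mc) * e₁ * (μ.real R₂ * μ.real (R₂ ∩ A₂ ∩ O₂) - μ.real (R₂ ∩ A₂) * μ.real (R₂ ∩ O₂)) +
          eo₁ * e₂ * (μ.real R₂ * μ.real (R₂ ∩ A₂ ∩ O₂ ∩ Mc) - μ.real (R₂ ∩ A₂) * μ.real (R₂ ∩ O₂ ∩ Mc)) := by
        rw [s1, s2]
        have : (1 - θ) * (eo₁ * e₂ + eo₂ * e₁) = μ.real (R₂ ∩ O₂ ∩ Mc) * e₁ := by rw [hθZ', heq₂]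
        linear_combination (μ.real R₂ * μ.real (R₂ ∩ A₂ ∩ O₂ ∩ Mr) - μ.real (R₂ ∩ A₂) * μ.real (R₂ ∩ O₂ ∩ Mr)) * this +
          (e₁ * (μ.real R₂ * μ.real (R₂ ∩ A₂ ∩ O₂ ∩ Mc) - μ.real (R₂ ∩ A₂) * μ.real (R₂ ∩ O₂ ∩ Mc))) * heq₂
      linarith [key, t2]

end UnionExchange

end Summit.CriticalPhenomena.PercolationContinuityZ3.Theorems

end
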